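import Mathlib.LinearAlgebra.LinearIndependent.Lemmas
import Mathlib.LinearAlgebra.Basis.Basic
import Mathlib.Algebra.BigOperators.Fin
import Mathlib.Tactic.Module
import Mathlib.Tactic.LinearCombination
import HarnessLib

/-!
# Weil-type ladder — three algebraic lemmas for the twisted composite families (pairs, projected double sums, three products)

b2b cell `hweil` (packet `run/shared/lean/b2b/hodge-weil/`), prover 3; pure linear algebra used by the kernel form of THEOREM EXC
(report `b2b-hweil-pv3-g46/COMPACT-PAIRS.md` §7, file `…TwistDecomposable`): independence of two basis vectors and of their
images under an injective map; the effect on a double sum `Σ_{j,j'} a_j b_{j'} w_{jj'}` of an operator that fixes (up to a common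
factor) the terms indexed by `J × J` and kills the rest; and the elimination behind "one of `G_0², G_1², G_0G_1` is a non-zero
multiple of `ω`": for a bilinear `f` with `f(Y,Y), f(X,Y) = f(Y,X), f(X,X) = αω, βω, γω`, `γ ≠ 0`, `p ≠ q`, `π ≠ 0`, the memberships
`π f(pᵏY + qᵏX, pˡY + qˡX) ∈ D` force `ω ∈ D` (else `(p−q)²γ = 0`).

Everything is proved; no definition, no named fact, no `sorry`; Mathlib + `HarnessLib` only. HONEST LABEL: bookkeeping; no rung.
[cite: Rohde2009CyclicCoverings, Ch. 6 §6.4] [cite: vanGeemen1994HodgeAV, §2.4]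
-/

-- every declaration of this problem lives in `Summit.HodgeConjecture.HodgeConjecture.…` (summit = sub-problem)
set_option linter.dupNamespace false

namespace Summit.HodgeConjecture.HodgeConjecture.WeilTypeLadder

section Algebra

variable {K V W : Type*} [Field K] [AddCommGroup V] [Module K V] [AddCommGroup W] [Module K W]

/-- Two distinct vectors of a basis are linearly independent. [folklore] -/
theorem linearIndependent_basis_pair {ι : Type*} (b : Module.Basis ι K V) {i j : ι} (h : i ≠ j) :
    LinearIndependent K ![b i, b j] := by
  classical
  refine LinearIndependent.pair_iff.2 fun s t hst => ?_
  have h1 := congrArg (fun v => b.repr v i) hst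
  have h2 := congrArg (fun v => b.repr v j) hst
  simp [h, h.symm] at h1 h2
  exact ⟨h1, h2⟩

/-- An injective linear map carries an independent pair to an independent pair. [folklore] -/
theorem linearIndependent_pair_map {x y : V} (h : LinearIndependent K ![x, y]) (f : V →ₗ[K] W)
    (hf : Function.Injective f) : LinearIndependent K ![f x, f y] := by
  refine LinearIndependent.pair_iff.2 fun s t hst => ?_
  have h0 : f (s • x + t • y) = 0 := by rw [map_add, map_smul, map_smul, hst]
  exact LinearIndependent.pair_iff.1 h s t (hf (by rw [h0, map_zero]))

/-- **The projected double sum**: an operator fixing (up to the factor `π`) the terms indexed by `J × J` and killing the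
others sends `Σ_{j,j'} a_j b_{j'} w_{jj'}` to `π Σ_{j,j' ∈ J} a_j b_{j'} w_{jj'}`. [folklore] -/
theorem apply_double_sum_eq_smul_sum {ι : Type*} [Fintype ι] (Pr : W →ₗ[K] W) (w : ι → ι → W) (J : Finset ι)
    (π : K) (hJ : ∀ j j', j ∈ J → j' ∈ J → Pr (w j j') = π • w j j')
    (h0 : ∀ j j', ¬ (j ∈ J ∧ j' ∈ J) → Pr (w j j') = 0) (a b : ι → K) :
    Pr (∑ j, ∑ j', (a j * b j') • w j j') = π • ∑ j ∈ J, ∑ j' ∈ J, (a j * b j') • w j j' := by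
  rw [map_sum]
  simp_rw [map_sum, map_smul]
  calc ∑ j, ∑ j', (a j * b j') • Pr (w j j')
      = ∑ j ∈ J, ∑ j', (a j * b j') • Pr (w j j') := by
        symm
        exact Finset.sum_subset (Finset.subset_univ J) fun j _ hj =>
          Finset.sum_eq_zero fun j' _ => by rw [h0 j j' (fun h => hj h.1), smul_zero]
    _ = ∑ j ∈ J, ∑ j' ∈ J, (a j * b j') • Pr (w j j') := by
        refine Finset.sum_congr rfl fun j _ => ?_
        symm
        exact Finset.sum_subset (Finset.subset_univ J) fun j' _ hj' => by
          rw [h0 j j' (fun h => hj' h.2), smul_zero]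
    _ = ∑ j ∈ J, ∑ j' ∈ J, π • ((a j * b j') • w j j') := by
        refine Finset.sum_congr rfl fun j hj => Finset.sum_congr rfl fun j' hj' => ?_
        rw [hJ j j' hj hj', smul_comm]
    _ = π • ∑ j ∈ J, ∑ j' ∈ J, (a j * b j') • w j j' := by
        rw [Finset.smul_sum]
        simp_rw [Finset.smul_sum]

/-- **The three products.** For a bilinear `f` with `f(Y,Y) = αω`, `f(X,Y) = f(Y,X) = βω`, `f(X,X) = γω`, `γ ≠ 0`, scalars
`p ≠ q`, `π ≠ 0`: if `π·f(pᵏY + qᵏX, pˡY + qˡX) ∈ D` for all `k, l`, then `ω ∈ D` — the three values `(k,l) = (0,0), (1,1),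
(0,1)` being zero would force `(p − q)²γ = 0`. [folklore] -/
theorem mem_of_three_products (f : V →ₗ[K] V →ₗ[K] W) (D : Submodule K W) {X Y : V} {ω : W} {α β γ p q π : K}
    (hYY : f Y Y = α • ω) (hXY : f X Y = β • ω) (hYX : f Y X = β • ω) (hXX : f X X = γ • ω) (hγ : γ ≠ 0)
    (hpq : p ≠ q) (hπ : π ≠ 0) (hmem : ∀ k l : ℕ, π • f (p ^ k • Y + q ^ k • X) (p ^ l • Y + q ^ l • X) ∈ D) :
    ω ∈ D := by
  have hR : ∀ k l : ℕ, π • f (p ^ k • Y + q ^ k • X) (p ^ l • Y + q ^ l • X) =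
      (π * (p ^ k * p ^ l * α + (p ^ k * q ^ l + q ^ k * p ^ l) * β + q ^ k * q ^ l * γ)) • ω := by
    intro k l
    simp only [map_add, map_smul, LinearMap.add_apply, LinearMap.smul_apply, hYY, hYX, hXY, hXX]
    module
  have key : ∀ k l : ℕ,
      p ^ k * p ^ l * α + (p ^ k * q ^ l + q ^ k * p ^ l) * β + q ^ k * q ^ l * γ ≠ 0 → ω ∈ D := by
    intro k l hr
    have h := hmem k l
    rw [hR] at h
    have hne := mul_ne_zero hπ hr
    rw [show ω = (π * (p ^ k * p ^ l * α + (p ^ k * q ^ l + q ^ k * p ^ l) * β + q ^ k * q ^ l * γ))⁻¹ •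
        ((π * (p ^ k * p ^ l * α + (p ^ k * q ^ l + q ^ k * p ^ l) * β + q ^ k * q ^ l * γ)) • ω) by
      rw [smul_smul, inv_mul_cancel₀ hne, one_smul]]
    exact D.smul_mem _ h
  by_contra hnot
  have e1 := not_not.1 fun h => hnot (key 0 0 h)
  have e2 := not_not.1 fun h => hnot (key 1 1 h)
  have e3 := not_not.1 fun h => hnot (key 0 1 h)
  simp only [pow_zero, pow_one, one_mul, mul_one] at e1 e2 e3
  have hsq : (p - q) ^ 2 * γ = 0 := by linear_combination p ^ 2 * e1 + e2 - 2 * p * e3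
  rcases mul_eq_zero.1 hsq with h | h
  · exact hpq (sub_eq_zero.1 ((pow_eq_zero_iff two_ne_zero).1 h))
  · exact hγ h

end Algebra

end Summit.HodgeConjecture.HodgeConjecture.WeilTypeLadder
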